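import Literature.Probability.LatticeModels.WeakBeurlingEstimate
import Literature.Probability.LatticeModels.HoleFreePotential
import HarnessLib

/-!
# The discrete Poincaré lemma on hole-free sets of faces of `ℤ²` (potentials of closed dual forms)

Topic `Literature/Probability/LatticeModels` (discrete planar topology on `ℤ²`; companion of
`HoleFreePotential.lean` — `HoleFree`, `FaceStep`, `HoleFree.erase_max` — and of the winding-number
toolkit of `Percolation/PlanarDuality.lean` / `WeakBeurlingEstimate.lean` — `walkWinding`,
`exists_mem_support_of_walkWinding_ne_zero`). This is the combinatorial existence theorem behind
the **discrete harmonic conjugate** of a discrete harmonic function with mixed boundary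
conditions (G. F. Lawler, O. Schramm, W. Werner, Ann. Probab. 32 (2004), §5.4, proof of Prop. 4.1:
"it is necessary to set some combinatorial infrastructure … there is a discrete harmonic
conjugate `k̂` defined on the vertices of `Ĥ†`; that is, for every directed edge `e = [u,v]` … the
discrete Cauchy–Riemann equation `ĥ(v) - ĥ(u) = k̂(v†) - k̂(u†)` holds"; their reference is to
the classical theory of discrete analytic functions on planar graphs, R. J. Duffin, *Basic
properties of discrete analytic functions*, Duke Math. J. 23 (1956)).

Faces of `ℤ²` are indexed by their lower-left corners, so that a set of faces is a set of sites
and side-adjacency of faces is the adjacency of `zdGraph 2`; the four faces around the vertex `v`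
are `v - e₀ - e₁`, `v - e₁`, `v`, `v - e₀` (counter-clockwise). A **dual `1`-form** is an
antisymmetric function `θ g g'` on ordered pairs of adjacent faces; its **circulation** about the
vertex `v` is `circ θ v = θ(v-e₀-e₁, v-e₁) + θ(v-e₁, v) + θ(v, v-e₀) + θ(v-e₀, v-e₀-e₁)`; a
**potential** on the face set `F` is a function `κ` with `κ g' - κ g = θ g g'` for all adjacent
`g, g' ∈ F` (`IsDualPotential`).

* **`exists_dualPotential_of_circ_eq_zero`** — if `F` is finite and hole-free and `circ θ v = 0`
  for every vertex `v` whose four faces lie in `F`, then `θ` has a potential on `F`.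

Proof: induction on `|F|`, removing the top-right face `s` (which keeps hole-freeness,
`HoleFree.erase_max`) and extending a potential `κ'` of `F ∖ {s}`: the only possible neighbours of
`s` in `F` are `L = s - e₀` and `B = s - e₁`; if both are present and the fourth face
`s - e₀ - e₁` is in `F`, the two candidate values at `s` agree by the circulation condition at the
corner `s`; if it is not in `F`, then `B` and `L` lie in different components of `F ∖ {s}` —
otherwise a dual path from `B` to `L` in `F ∖ {s}` closed up through `s` is a closed lattice walk in
`F` with winding number `-1` about that fourth face (its only step across the horizontal
half-line through the corner of `s` to the right is the down-step `s → B`, by the maximality of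
`s`), which the escape path of the fourth face to infinity outside `F` (hole-freeness) would have
to meet (`exists_mem_support_of_walkWinding_ne_zero`) — so `κ'` can be shifted by a constant on
the component of `B`. Everything is proved. (The tree's `HoleFreePotential.lean` proves the
analogous statement for Smirnov's CORNER forms — potentials on vertices and faces jointly — by a
parity count; the present dual-edge version, with its winding-number proof, is the one matching the
Cauchy–Riemann structure `dĥ ↔ dk̂` of a harmonic conjugate.)

## References

* G. F. Lawler, O. Schramm, W. Werner, Ann. Probab. 32 (2004), §5.4. [LawlerSchrammWerner2004]
* R. J. Duffin, *Basic properties of discrete analytic functions*, Duke Math. J. 23 (1956)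
  335–363.
-/

noncomputable section

namespace Literature.Probability.LatticeModels

open Finset SimpleGraph Literature.Probability.Percolation WeakBeurling

/-! ### Dual forms, circulation, potentials -/

/-- The unit vector `e₀`. [folklore] -/
abbrev ex : Site 2 := Pi.single 0 1
/-- The unit vector `e₁`. [folklore] -/
abbrev ey : Site 2 := Pi.single 1 1

/-- **The circulation of a dual form about the vertex `v`**: the sum of `θ` along the
counter-clockwise cycle of the four faces `v - e₀ - e₁ → v - e₁ → v → v - e₀ → v - e₀ - e₁`
sharing the corner `v`. [folklore] -/
def circ (θ : Site 2 → Site 2 → ℝ) (v : Site 2) : ℝ :=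
  θ (v - ex - ey) (v - ey) + θ (v - ey) v + θ v (v - ex) + θ (v - ex) (v - ex - ey)

/-- **`κ` is a potential of the dual form `θ` on the face set `F`**: `κ g' - κ g = θ g g'` for
all side-adjacent faces `g, g' ∈ F` (the discrete Cauchy–Riemann / exactness relation).
[folklore] -/
def IsDualPotential (F : Finset (Site 2)) (θ : Site 2 → Site 2 → ℝ) (κ : Site 2 → ℝ) : Prop :=
  ∀ g g' : Site 2, (zdGraph 2).Adj g g' → g ∈ F → g' ∈ F → κ g' - κ g = θ g g'

/-! ### Lattice steps in coordinates -/

/-- The neighbours of a site are `s ± e₀`, `s ± e₁`. [folklore] -/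
theorem eq_of_adj {s g : Site 2} (h : (zdGraph 2).Adj s g) :
    g = s + ex ∨ g = s - ex ∨ g = s + ey ∨ g = s - ey := by
  rcases stepKind_of_adj h with ⟨h0, h1⟩ | ⟨h0, h1⟩ | ⟨h1, h0⟩ | ⟨h1, h0⟩
  · left; rw [Site.eq_iff_two]; simp; omega
  · right; left; rw [Site.eq_iff_two]; simp; omega
  · right; right; left; rw [Site.eq_iff_two]; simp; omega
  · right; right; right; rw [Site.eq_iff_two]; simp; omega

/-- `s - e₀` is adjacent to `s`. [folklore] -/
theorem adj_sub_ex (s : Site 2) : (zdGraph 2).Adj (s - ex) s :=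
  adj_of_stepKind (.right (by simp) (by simp))

/-- `s - e₁` is adjacent to `s`. [folklore] -/
theorem adj_sub_ey (s : Site 2) : (zdGraph 2).Adj (s - ey) s :=
  adj_of_stepKind (.up (by simp) (by simp))

/-- `s - e₀ - e₁` is adjacent to `s - e₁`. [folklore] -/
theorem adj_sub_ex_sub_ey_sub_ey (s : Site 2) : (zdGraph 2).Adj (s - ex - ey) (s - ey) :=
  adj_of_stepKind (.right (by simp) (by simp))

/-- `s - e₀` is adjacent to `s - e₀ - e₁`. [folklore] -/
theorem adj_sub_ex_sub_ex_sub_ey (s : Site 2) : (zdGraph 2).Adj (s - ex) (s - ex - ey) :=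
  adj_of_stepKind (.down (by simp) (by simp))

/-! ### Walks from step chains -/

/-- A chain of steps inside `F'` yields a lattice walk supported in `F'`. [folklore] -/
theorem exists_walk_of_reflTransGen_in {F' : Finset (Site 2)} {g g' : Site 2} (hg : g ∈ F')
    (h : Relation.ReflTransGen (fun a b ↦ (zdGraph 2).Adj a b ∧ a ∈ F' ∧ b ∈ F') g g') :
    ∃ w : (zdGraph 2).Walk g g', ∀ z ∈ w.support, z ∈ F' := by
  induction h with
  | refl => exact ⟨Walk.nil, fun z hz ↦ by simp at hz; rw [hz]; exact hg⟩
  | tail _ hab ih =>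
    obtain ⟨w, hw⟩ := ih
    refine ⟨w.append (Walk.cons hab.1 Walk.nil), fun z hz ↦ ?_⟩
    rw [Walk.support_append] at hz
    rcases List.mem_append.1 hz with hz | hz
    · exact hw z hz
    · simp at hz; rw [hz]; exact hab.2.2

/-- A chain of face steps outside `P` yields a lattice walk supported outside `P` (the same
statement as `exists_walk_of_reflTransGen_faceStep` of `KCBoundarySmallness.lean`, an Ising-specific
module not imported here). [folklore] -/
theorem exists_walk_of_faceStep_chain {P : Set (Site 2)} {g g' : Site 2} (hg : g ∉ P)
    (h : Relation.ReflTransGen (FaceStep P) g g') :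
    ∃ w : (zdGraph 2).Walk g g', ∀ z ∈ w.support, z ∉ P := by
  induction h with
  | refl => exact ⟨Walk.nil, fun z hz ↦ by simp at hz; rw [hz]; exact hg⟩
  | tail _ hab ih =>
    obtain ⟨w, hw⟩ := ih
    refine ⟨w.append (Walk.cons hab.1 Walk.nil), fun z hz ↦ ?_⟩
    rw [Walk.support_append] at hz
    rcases List.mem_append.1 hz with hz | hz
    · exact hw z hz
    · simp at hz; rw [hz]; exact hab.2.2

/-! ### The winding computation about the corner of the top-right face -/

/-- Steps inside `F ∖ {s}`, `s` the top-right face of `F`, never cross the horizontal half-line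
through the corner of `s` to the right: their winding about `s - e₀ - e₁` vanishes. [folklore] -/
theorem stepWinding_eq_zero_of_max {F : Finset (Site 2)} {s : Site 2}
    (hmax : ∀ t ∈ F, t 1 < s 1 ∨ (t 1 = s 1 ∧ t 0 ≤ s 0)) {x y : Site 2} (hxy : (zdGraph 2).Adj x y)
    (hx : x ∈ F.erase s) (hy : y ∈ F.erase s) : stepWinding (s - ex - ey) x y = 0 := by
  have hs : (s - ex - ey) 0 = s 0 - 1 ∧ (s - ex - ey) 1 = s 1 - 1 := by simp
  rcases stepKind_of_adj hxy with ⟨h0, h1⟩ | ⟨h0, h1⟩ | ⟨h1, h0⟩ | ⟨h1, h0⟩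
  · exact stepWinding_right h0
  · exact stepWinding_left h0
  · rw [stepWinding_up h1 h0, if_neg]
    rintro ⟨hx1, hx0⟩
    -- `y` is in the top row at a column `≥ s 0`, but `y ≠ s`
    obtain ⟨hys, hyF⟩ := Finset.mem_erase.1 hy
    have hy1 : y 1 = s 1 := by rw [h1, hx1, hs.2]; ring
    rcases hmax y hyF with h | ⟨-, h⟩
    · omega
    · apply hys
      rw [Site.eq_iff_two]; constructor <;> omega
  · rw [stepWinding_down h1 h0, neg_eq_zero, if_neg]
    rintro ⟨hy1, hy0⟩
    obtain ⟨hxs, hxF⟩ := Finset.mem_erase.1 hx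
    have hx1 : x 1 = s 1 := by rw [h1, hy1, hs.2]; ring
    rcases hmax x hxF with h | ⟨-, h⟩
    · omega
    · apply hxs
      rw [Site.eq_iff_two]; constructor <;> omega

/-- Walks inside `F ∖ {s}` do not wind about the corner of the top-right face `s`. [folklore] -/
theorem walkWinding_eq_zero_of_max {F : Finset (Site 2)} {s : Site 2}
    (hmax : ∀ t ∈ F, t 1 < s 1 ∨ (t 1 = s 1 ∧ t 0 ≤ s 0)) {a b : Site 2} (w : (zdGraph 2).Walk a b)
    (hw : ∀ z ∈ w.support, z ∈ F.erase s) : walkWinding w (s - ex - ey) = 0 := by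
  induction w with
  | nil => rfl
  | cons h p ih =>
    rename_i x y z
    rw [walkWinding_cons, stepWinding_eq_zero_of_max hmax h (hw x (by simp)) (hw y (by simp)),
      zero_add]
    exact ih fun u hu ↦ hw u (by simp [hu])

/-- **The winding number `-1`**: the closed walk `s → s - e₁ → (inside F ∖ {s}) → s - e₀ → s`
winds `-1` times about the fourth face `s - e₀ - e₁` at the corner of the top-right face `s`.
[folklore] -/
theorem walkWinding_corner_cycle {F : Finset (Site 2)} {s : Site 2}
    (hmax : ∀ t ∈ F, t 1 < s 1 ∨ (t 1 = s 1 ∧ t 0 ≤ s 0))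
    (π : (zdGraph 2).Walk (s - ey) (s - ex)) (hπ : ∀ z ∈ π.support, z ∈ F.erase s) :
    walkWinding (Walk.cons (adj_sub_ey s).symm (π.append (Walk.cons (adj_sub_ex s) Walk.nil)))
      (s - ex - ey) = -1 := by
  rw [walkWinding_cons, walkWinding_append, walkWinding_cons, walkWinding_nil,
    walkWinding_eq_zero_of_max hmax π hπ]
  have h1 : stepWinding (s - ex - ey) s (s - ey) = -1 := by
    rw [stepWinding_down (by simp) (by simp), if_pos]
    constructor <;> simp
  have h2 : stepWinding (s - ex - ey) (s - ex) s = 0 := stepWinding_right (by simp)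
  rw [h1, h2]; ring

/-! ### The extension step -/

/-- **`B = s - e₁` and `L = s - e₀` are disconnected in `F ∖ {s}`** when the fourth face
`s - e₀ - e₁` is not in the hole-free `F` (`s` its top-right face): a connecting dual path would
close up through `s` into a lattice cycle in `F` winding about that face, which escapes to
infinity outside `F`. [folklore] -/
theorem not_reflTransGen_of_corner_not_mem {F : Finset (Site 2)} (hF : HoleFree (↑F : Set (Site 2)))
    {s : Site 2} (hs : s ∈ F) (hmax : ∀ t ∈ F, t 1 < s 1 ∨ (t 1 = s 1 ∧ t 0 ≤ s 0))
    (hBL : s - ex - ey ∉ F) (hB : s - ey ∈ F.erase s) :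
    ¬ Relation.ReflTransGen (fun a b ↦ (zdGraph 2).Adj a b ∧ a ∈ F.erase s ∧ b ∈ F.erase s)
      (s - ey) (s - ex) := by
  intro hreach
  obtain ⟨π, hπ⟩ := exists_walk_of_reflTransGen_in hB hreach
  set C := Walk.cons (adj_sub_ey s).symm (π.append (Walk.cons (adj_sub_ex s) Walk.nil)) with hC
  have hwind : walkWinding C (s - ex - ey) = -1 := walkWinding_corner_cycle hmax π hπ
  have hCsupp : ∀ z ∈ C.support, z ∈ F := by
    intro z hz
    rw [hC, Walk.support_cons, List.mem_cons, Walk.support_append, List.mem_append] at hz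
    rcases hz with hz | hz | hz
    · rw [hz]; exact hs
    · exact Finset.mem_of_mem_erase (hπ z hz)
    · simp at hz; rw [hz]; exact hs
  -- a box about the fourth face containing `C`
  obtain ⟨n, hn0, hn⟩ : ∃ n : ℤ, 0 ≤ n ∧ ∀ g ∈ F, |g 0 - (s - ex - ey) 0| ≤ n ∧ |g 1 - (s - ex - ey) 1| ≤ n := by
    let f : Site 2 → ℤ := fun g ↦ |g 0 - (s - ex - ey) 0| + |g 1 - (s - ex - ey) 1|
    refine ⟨F.sup' ⟨s, hs⟩ f, ?_, fun g hg ↦ ?_⟩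
    · have h := Finset.le_sup' f hs
      have : 0 ≤ f s := add_nonneg (abs_nonneg _) (abs_nonneg _)
      exact this.trans h
    · have h := Finset.le_sup' f hg
      have h1 : |g 0 - (s - ex - ey) 0| ≤ f g := le_add_of_nonneg_right (abs_nonneg _)
      have h2 : |g 1 - (s - ex - ey) 1| ≤ f g := le_add_of_nonneg_left (abs_nonneg _)
      exact ⟨h1.trans h, h2.trans h⟩
  have hbox : ∀ z ∈ C.support, z ∈ sqBox (s - ex - ey) n := fun z hz ↦ by
    rw [mem_sqBox]; exact hn z (hCsupp z hz)
  -- the fourth face escapes the box outside `F`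
  have hBL' : (s - ex - ey) ∉ (↑F : Set (Site 2)) := by exact_mod_cast hBL
  obtain ⟨g', hg'M, hchain⟩ := hF _ hBL' ((s - ex - ey) 1 + n + 1)
  obtain ⟨q, hq⟩ := exists_walk_of_faceStep_chain hBL' hchain
  have hd : g' ∉ sqBox (s - ex - ey) n := by
    rw [mem_sqBox]; rintro ⟨-, h2⟩
    have := (abs_le.1 h2).2
    omega
  obtain ⟨z, hzq, hzC⟩ := exists_mem_support_of_walkWinding_ne_zero hbox (by rw [hwind]; norm_num) hd q
  exact hq z hzq (hCsupp z hzC)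

/-- Adjacent faces of `F'` are equally reachable from any face by step chains inside `F'`.
[folklore] -/
theorem reflTransGen_iff_of_adj {F' : Finset (Site 2)} {b g g' : Site 2} (hadj : (zdGraph 2).Adj g g')
    (hg : g ∈ F') (hg' : g' ∈ F') :
    Relation.ReflTransGen (fun a b ↦ (zdGraph 2).Adj a b ∧ a ∈ F' ∧ b ∈ F') b g ↔
      Relation.ReflTransGen (fun a b ↦ (zdGraph 2).Adj a b ∧ a ∈ F' ∧ b ∈ F') b g' :=
  ⟨fun h ↦ h.tail ⟨hadj, hg, hg'⟩, fun h ↦ h.tail ⟨hadj.symm, hg', hg⟩⟩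

/-- **The extension step**: a potential on `F ∖ {s}`, `s` the top-right face of the hole-free
`F`, extends to a potential on `F`, when `θ` is antisymmetric and its circulation vanishes about
every vertex whose four faces lie in `F`. [folklore] -/
theorem exists_dualPotential_insert_max {F : Finset (Site 2)} (hF : HoleFree (↑F : Set (Site 2)))
    {s : Site 2} (hs : s ∈ F) (hmax : ∀ t ∈ F, t 1 < s 1 ∨ (t 1 = s 1 ∧ t 0 ≤ s 0))
    {θ : Site 2 → Site 2 → ℝ} (hθ : ∀ g g' : Site 2, (zdGraph 2).Adj g g' → θ g' g = -θ g g')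
    (hcirc : ∀ v : Site 2, v ∈ F → v - ex ∈ F → v - ey ∈ F → v - ex - ey ∈ F → circ θ v = 0)
    {κ' : Site 2 → ℝ} (hκ' : IsDualPotential (F.erase s) θ κ') : ∃ κ : Site 2 → ℝ, IsDualPotential F θ κ := by
  classical
  have hright : s + ex ∉ F := fun h ↦ by
    rcases hmax _ h with h | ⟨-, h⟩ <;> simp at h
  have hup : s + ey ∉ F := fun h ↦ by
    rcases hmax _ h with h | ⟨h, -⟩ <;> simp at h
  -- neighbours of `s` in `F` are `s - e₀` or `s - e₁`
  have hnbr : ∀ g : Site 2, (zdGraph 2).Adj s g → g ∈ F → g = s - ex ∨ g = s - ey := by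
    intro g hadj hg
    rcases eq_of_adj hadj with h | h | h | h
    · exact absurd (h ▸ hg) hright
    · exact Or.inl h
    · exact absurd (h ▸ hg) hup
    · exact Or.inr h
  -- generic assembly: from a potential `μ` on `F.erase s` and a value `c` at `s` compatible with
  -- both possible neighbours
  have assemble : ∀ (μ : Site 2 → ℝ) (c : ℝ), IsDualPotential (F.erase s) θ μ →
      (s - ex ∈ F → c - μ (s - ex) = θ (s - ex) s) → (s - ey ∈ F → c - μ (s - ey) = θ (s - ey) s) →
      ∃ κ : Site 2 → ℝ, IsDualPotential F θ κ := by
    intro μ c hμ hL hB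
    refine ⟨Function.update μ s c, fun g g' hadj hg hg' ↦ ?_⟩
    by_cases hgs : g = s
    · subst hgs
      have hg's : g' ≠ g := hadj.ne.symm
      rw [Function.update_self, Function.update_of_ne hg's]
      rcases hnbr g' hadj hg' with h | h <;> subst h
      · rw [hθ _ _ (adj_sub_ex g)]; linarith [hL hg']
      · rw [hθ _ _ (adj_sub_ey g)]; linarith [hB hg']
    by_cases hg's : g' = s
    · subst hg's
      rw [Function.update_self, Function.update_of_ne hgs]
      rcases hnbr g hadj.symm hg with h | h <;> subst h
      · exact hL hg
      · exact hB hg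
    · rw [Function.update_of_ne hg's, Function.update_of_ne hgs]
      exact hμ g g' hadj (Finset.mem_erase.2 ⟨hgs, hg⟩) (Finset.mem_erase.2 ⟨hg's, hg'⟩)
  by_cases hL : s - ex ∈ F
  · by_cases hB : s - ey ∈ F
    · -- both neighbours present
      have hLe : s - ex ∈ F.erase s := Finset.mem_erase.2 ⟨(adj_sub_ex s).ne, hL⟩
      have hBe : s - ey ∈ F.erase s := Finset.mem_erase.2 ⟨(adj_sub_ey s).ne, hB⟩
      set D : ℝ := (κ' (s - ey) + θ (s - ey) s) - (κ' (s - ex) + θ (s - ex) s) with hD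
      by_cases hBL : s - ex - ey ∈ F
      · -- consistency from the circulation about the corner `s`
        have hBLe : s - ex - ey ∈ F.erase s :=
          Finset.mem_erase.2 ⟨(adj_sub_ex_sub_ey_sub_ey s).ne.symm ∘ (fun h ↦ by
            have := congrArg (· 1) h; simp at this), hBL⟩
        have hc := hcirc s hs hL hB hBL
        have h1 := hκ' _ _ (adj_sub_ex_sub_ey_sub_ey s) hBLe hBe
        have h2 := hκ' _ _ (adj_sub_ex_sub_ex_sub_ey s) hLe hBLe
        have hD0 : D = 0 := by
          rw [hD]
          rw [circ] at hc
          have h3 := hθ _ _ (adj_sub_ex s)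
          linarith
        refine assemble κ' (κ' (s - ex) + θ (s - ex) s) hκ' (fun _ ↦ by ring) (fun _ ↦ ?_)
        linarith
      · -- `B` and `L` are disconnected in `F ∖ {s}`: shift `κ'` on the component of `B`
        have hdisc := not_reflTransGen_of_corner_not_mem hF hs hmax hBL hBe
        set R : Site 2 → Prop := fun g ↦
          Relation.ReflTransGen (fun a b ↦ (zdGraph 2).Adj a b ∧ a ∈ F.erase s ∧ b ∈ F.erase s)
            (s - ey) g with hR
        set μ : Site 2 → ℝ := fun g ↦ if R g then κ' g - D else κ' g with hμ
        have hμpot : IsDualPotential (F.erase s) θ μ := by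
          intro g g' hadj hg hg'
          have hiff : R g ↔ R g' := reflTransGen_iff_of_adj hadj hg hg'
          by_cases hRg : R g
          · have hRg' : R g' := hiff.1 hRg
            simp only [hμ, if_pos hRg, if_pos hRg']
            have := hκ' g g' hadj hg hg'
            linarith
          · have hRg' : ¬ R g' := fun h ↦ hRg (hiff.2 h)
            simp only [hμ, if_neg hRg, if_neg hRg']
            exact hκ' g g' hadj hg hg'
        have hμL : μ (s - ex) = κ' (s - ex) := by
          simp only [hμ, if_neg (show ¬ R (s - ex) from hdisc)]
        have hμB : μ (s - ey) = κ' (s - ey) - D := by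
          simp only [hμ, if_pos (show R (s - ey) from Relation.ReflTransGen.refl)]
        refine assemble μ (κ' (s - ex) + θ (s - ex) s) hμpot (fun _ ↦ by rw [hμL]; ring)
          (fun _ ↦ ?_)
        rw [hμB, hD]; ring
    · exact assemble κ' (κ' (s - ex) + θ (s - ex) s) hκ' (fun _ ↦ by ring) (fun h ↦ absurd h hB)
  · by_cases hB : s - ey ∈ F
    · exact assemble κ' (κ' (s - ey) + θ (s - ey) s) hκ' (fun h ↦ absurd h hL) (fun _ ↦ by ring)
    · exact assemble κ' 0 hκ' (fun h ↦ absurd h hL) (fun h ↦ absurd h hB)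

/-! ### The theorem -/

/-- **The discrete Poincaré lemma on hole-free face sets** (existence of the discrete harmonic
conjugate, topological part; cf. Lawler–Schramm–Werner (2004), §5.4, and Duffin (1956)): let `F`
be a finite hole-free set of faces of `ℤ²` and `θ` an antisymmetric dual `1`-form whose
circulation vanishes about every vertex whose four faces lie in `F`. Then `θ` has a potential
`κ` on `F`: `κ g' - κ g = θ g g'` for all side-adjacent faces `g, g' ∈ F`. (Induction on `|F|`
through the top-right face, `exists_dualPotential_insert_max`; compare the corner-form version
`exists_potential_of_holeFree` of `HoleFreePotential.lean`.)
[cite: LawlerSchrammWerner2004, §5.4 (proof of Prop. 4.1)] -/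
theorem exists_dualPotential_of_circ_eq_zero {F : Finset (Site 2)} (hF : HoleFree (↑F : Set (Site 2)))
    {θ : Site 2 → Site 2 → ℝ} (hθ : ∀ g g' : Site 2, (zdGraph 2).Adj g g' → θ g' g = -θ g g')
    (hcirc : ∀ v : Site 2, v ∈ F → v - ex ∈ F → v - ey ∈ F → v - ex - ey ∈ F → circ θ v = 0) :
    ∃ κ : Site 2 → ℝ, IsDualPotential F θ κ := by
  classical
  -- induction on the cardinality
  suffices h : ∀ (n : ℕ) (F : Finset (Site 2)), F.card = n → HoleFree (↑F : Set (Site 2)) →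
      (∀ v : Site 2, v ∈ F → v - ex ∈ F → v - ey ∈ F → v - ex - ey ∈ F → circ θ v = 0) →
      ∃ κ : Site 2 → ℝ, IsDualPotential F θ κ from h _ F rfl hF hcirc
  intro n
  induction n with
  | zero =>
    intro F hcard _ _
    rw [Finset.card_eq_zero] at hcard
    subst hcard
    exact ⟨fun _ ↦ 0, fun g g' _ hg _ ↦ absurd hg (Finset.notMem_empty g)⟩
  | succ n ih =>
    intro F hcard hF hcirc
    have hne : F.Nonempty := Finset.card_pos.1 (by omega)
    -- the top-right face
    obtain ⟨s, hs, hmax'⟩ := Finset.exists_max_image F (fun t : Site 2 ↦ toLex (t 1, t 0)) hne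
    have hmax : ∀ t ∈ F, t 1 < s 1 ∨ (t 1 = s 1 ∧ t 0 ≤ s 0) := fun t ht ↦ by
      have h := hmax' t ht
      rcases Prod.Lex.le_iff.1 h with h | ⟨h1, h2⟩
      · exact Or.inl h
      · exact Or.inr ⟨h1, h2⟩
    -- the potential on `F ∖ {s}`
    have hF' : HoleFree (↑(F.erase s) : Set (Site 2)) := by
      rw [Finset.coe_erase]
      exact hF.erase_max hmax
    obtain ⟨κ', hκ'⟩ := ih (F.erase s) (by rw [Finset.card_erase_of_mem hs, hcard]; omega) hF'
      (fun v hv h1 h2 h3 ↦ hcirc v (Finset.mem_of_mem_erase hv) (Finset.mem_of_mem_erase h1)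
        (Finset.mem_of_mem_erase h2) (Finset.mem_of_mem_erase h3))
    exact exists_dualPotential_insert_max hF hs hmax hθ hcirc hκ'

/-- **Uniqueness up to constants on dual-connected pieces**: two potentials of the same form
differ by a constant along chains of adjacent faces of `F`. [folklore] -/
theorem dualPotential_sub_eq_of_reflTransGen {F : Finset (Site 2)} {θ : Site 2 → Site 2 → ℝ}
    {κ₁ κ₂ : Site 2 → ℝ} (h₁ : IsDualPotential F θ κ₁) (h₂ : IsDualPotential F θ κ₂) {g g' : Site 2}
    (h : Relation.ReflTransGen (fun a b ↦ (zdGraph 2).Adj a b ∧ a ∈ F ∧ b ∈ F) g g') :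
    κ₁ g' - κ₂ g' = κ₁ g - κ₂ g := by
  induction h with
  | refl => rfl
  | tail _ hab ih =>
    have e1 := h₁ _ _ hab.1 hab.2.1 hab.2.2
    have e2 := h₂ _ _ hab.1 hab.2.1 hab.2.2
    linarith

end Literature.Probability.LatticeModels
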